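import Summits.Ventures.HodgeRepro2.T5FinitePlaceNormIndex
import Summits.Ventures.HodgeRepro2.T5FinitePlaceSumTwoNorms

/-!
# `(U)` — binary universality on the route's `E_w` at every non-dyadic non-split place, and the consequences:
Shimura's Lemma 1.6, row N2.8.1 (i) and HKS96's two classes UNCONDITIONAL there (cell pub-hodge-repro2, seat p3)

Tier-5 N2 support, rows N2.2.2 / N2.8.1 of route/T5-N2-route-3.md. File 136's hypothesis `(U) = BinaryUniversal E`
(«every binary diagonal hermitian form `⟨a, b⟩` represents every `c ∈ F^×`», the local input of every printed
proof of Lemma 1.6 — Jacobowitz 1962 / Shimura [S2] Prop. 5.3) is PROVED here on `E_w` with file 119's star,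
at every finite place `v` of `F` non-split in `E` with `2 ∈ O_{F_v}^×`:

* `binaryUniversal`: for star-fixed non-zero `a, b, c` of `E_w` (= elements of `F_v`), with `N` the norm group
  of `E_w/F_v` (index 2 by file 141's `indexTwo`): if `c/a ∈ N`, take `y = 0`; if `c/b ∈ N`, take `x = 0`;
  otherwise `b/a ∈ N` (the product of two non-norms is a norm) and `c/a = N(x₁) + N(x₂)` by file 142's `(U′)`,
  whence `N(x₁) a + N(x₂ / z) b = c` for `N(z) = b/a`;
* the corollaries on `E_w` with NO binder left: `isCongruent_iff_exists_det_eq_local` (Shimura Lemma 1.6, Doc.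
  Math. 13 p. 745 ll. 22–23: congruent ⟺ same dimension and determinants differing by a norm),
  `isCongruent_iff_hilbertSolvable_local` (row N2.8.1 (i): `W ≅ W′ ⟺ (c, θ/v) = 1`),
  `exists_two_classes_local'` (HKS96's «precisely two isomorphism classes in each dimension»).

What stays print: `(U)` at the DYADIC places `v ∣ 2` (Jacobowitz 1962; O'Meara 63:19's quinary isotropy in the
dyadic case). Mathlib + files 115–119, 133–142 (this seat) + seat p4's chain only; no display; no device.
§8(d): uses an L-value-free non-vanishing device: NO.
-/

namespace Summit.Ventures.HodgeRepro2.T5FinitePlaceBinaryUniversal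

open IsDedekindDomain IsDedekindDomain.HeightOneSpectrum NumberField Module
open Summit.Ventures.HodgeRepro2.T5FinitePlaceTensorEquiv Summit.Ventures.HodgeRepro2.T5FinitePlaceStar
  Summit.Ventures.HodgeRepro2.T5FinitePlaceIsometryCriterion Summit.Ventures.HodgeRepro2.T5HilbertSymbolNorm
  Summit.Ventures.HodgeRepro2.T5HermitianDetClass Summit.Ventures.HodgeRepro2.T5HermitianClassify
  Summit.Ventures.HodgeRepro2.T5HermitianTwoClasses Summit.Ventures.HodgeRepro2.T5AdicCompletionNormGroup
  Summit.Ventures.HodgeRepro2.T5LocalNormIndex Summit.Ventures.HodgeRepro2.T5FinitePlaceNormIndex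
  Summit.Ventures.HodgeRepro2.T5FinitePlaceSumTwoNorms

/-! As in file 141, the namespace `T5FinitePlaceLiesOver` is not opened: `algebraMap (v.adicCompletion F)
(w.adicCompletion E)` is seat p4's global instance throughout. -/

section Universal

variable {F E : Type*} [Field F] [NumberField F] [Field E] [NumberField E] [Algebra F E]
  [Algebra.IsQuadraticExtension F E]
variable (v : HeightOneSpectrum (𝓞 F)) (w : HeightOneSpectrum (𝓞 E)) [w.asIdeal.LiesOver v.asIdeal]
variable {s : E} {θ : F}
variable (hs : s ^ 2 = algebraMap F E θ) (hspan : Submodule.span F {(1 : E), s} = ⊤)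
  (hsq : ¬ IsSquare (algebraMap F (v.adicCompletion F) θ)) (c : E ≃ₐ[F] E) (hc : c s = -s)
  (h2u : IsUnit (2 : adicCompletionIntegers F v))

include h2u in
/-- **`(U)` on `E_w` at a non-dyadic non-split place:** every binary diagonal hermitian form `⟨a, b⟩` with
`a, b ∈ F_v^×` represents every `c ∈ F_v^×` — file 136's `BinaryUniversal (w.adicCompletion E)` with file 119's
star, from `IndexTwo E_w` (file 141) and `(U′)` (file 142). -/
theorem binaryUniversal :
    letI := localStarRing v w hs hspan hsq c hc
    BinaryUniversal (w.adicCompletion E) := by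
  letI := localStarRing v w hs hspan hsq c hc
  have h2 := finrank_eq_two' v w hs hspan hsq
  have hσ := localConj_ne_one v w hs hspan hsq c hc
  have hidx := index_normGroup_eq_two v w (localConj v w hs hspan hsq c) h2 hσ
  intro a b c₀ ha hb hc₀ ha0 hb0 hc₀0
  obtain ⟨ya, rfl⟩ := exists_algebraMap_eq_of_star_eq_self v w hs hspan hsq c hc ha
  obtain ⟨yb, rfl⟩ := exists_algebraMap_eq_of_star_eq_self v w hs hspan hsq c hc hb
  obtain ⟨yc, rfl⟩ := exists_algebraMap_eq_of_star_eq_self v w hs hspan hsq c hc hc₀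
  have hya : ya ≠ 0 := fun h => ha0 (by rw [h, map_zero])
  have hyb : yb ≠ 0 := fun h => hb0 (by rw [h, map_zero])
  have hyc : yc ≠ 0 := fun h => hc₀0 (by rw [h, map_zero])
  have hP : algebraMap (v.adicCompletion F) (w.adicCompletion E) ya ≠ 0 := (map_ne_zero _).2 hya
  -- Case 1: `c/a` is a norm
  by_cases h1 : Units.mk0 yc hyc * (Units.mk0 ya hya)⁻¹ ∈ normGroup v w (localConj v w hs hspan hsq c)
  · obtain ⟨x, hx⟩ := h1
    refine ⟨x, 0, ?_⟩
    rw [star_zero, zero_mul, zero_mul, add_zero, ← localConj_eq_star v w hs hspan hsq c hc,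
      mul_comm (localConj v w hs hspan hsq c x) x, hx, ← map_mul, Units.val_mul, Units.val_inv_eq_inv_val,
      Units.val_mk0, Units.val_mk0, inv_mul_cancel_right₀ hya]
  -- Case 2: `c/b` is a norm
  by_cases h2' : Units.mk0 yc hyc * (Units.mk0 yb hyb)⁻¹ ∈ normGroup v w (localConj v w hs hspan hsq c)
  · obtain ⟨y, hy⟩ := h2'
    refine ⟨0, y, ?_⟩
    rw [star_zero, zero_mul, zero_mul, zero_add, ← localConj_eq_star v w hs hspan hsq c hc,
      mul_comm (localConj v w hs hspan hsq c y) y, hy, ← map_mul, Units.val_mul, Units.val_inv_eq_inv_val,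
      Units.val_mk0, Units.val_mk0, inv_mul_cancel_right₀ hyb]
  -- Case 3: neither is a norm, so `b/a = (c/a) · (c/b)⁻¹` is a norm
  have h3 : Units.mk0 yb hyb * (Units.mk0 ya hya)⁻¹ ∈ normGroup v w (localConj v w hs hspan hsq c) := by
    have hmem := (Subgroup.mul_mem_iff_of_index_two hidx).2
      (iff_of_false h1 fun h => h2' (Subgroup.inv_mem_iff _ |>.1 h))
    have e : Units.mk0 yc hyc * (Units.mk0 ya hya)⁻¹ * (Units.mk0 yc hyc * (Units.mk0 yb hyb)⁻¹)⁻¹ =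
        Units.mk0 yb hyb * (Units.mk0 ya hya)⁻¹ := by
      apply Units.ext
      simp only [Units.val_mul, Units.val_inv_eq_inv_val, Units.val_mk0, mul_inv_rev, inv_inv]
      field_simp
    rwa [e] at hmem
  obtain ⟨x₁, x₂, hx⟩ := isSumTwoNorms v w (localConj v w hs hspan hsq c) h2 hσ h2u
    (Units.mk0 yc hyc * (Units.mk0 ya hya)⁻¹)
  obtain ⟨z, hz⟩ := h3
  have hz0 : z ≠ 0 := by
    rintro rfl
    rw [zero_mul, eq_comm, map_eq_zero] at hz
    exact (Units.mk0 yb hyb * (Units.mk0 ya hya)⁻¹).ne_zero hz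
  have hσz : localConj v w hs hspan hsq c z ≠ 0 := (map_ne_zero _).2 hz0
  -- the two identities `(N x₁ + N x₂) · a = c` and `N z · a = b`
  have hx' : (x₁ * localConj v w hs hspan hsq c x₁ + x₂ * localConj v w hs hspan hsq c x₂) *
      algebraMap (v.adicCompletion F) (w.adicCompletion E) ya =
        algebraMap (v.adicCompletion F) (w.adicCompletion E) yc := by
    rw [hx, Units.val_mul, Units.val_inv_eq_inv_val, Units.val_mk0, Units.val_mk0, map_mul, map_inv₀,
      inv_mul_cancel_right₀ hP]
  have hz' : (z * localConj v w hs hspan hsq c z) * algebraMap (v.adicCompletion F) (w.adicCompletion E) ya =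
      algebraMap (v.adicCompletion F) (w.adicCompletion E) yb := by
    rw [hz, Units.val_mul, Units.val_inv_eq_inv_val, Units.val_mk0, Units.val_mk0, map_mul, map_inv₀,
      inv_mul_cancel_right₀ hP]
  refine ⟨x₁, x₂ / z, ?_⟩
  rw [← localConj_eq_star v w hs hspan hsq c hc, ← localConj_eq_star v w hs hspan hsq c hc, map_div₀, ← hz',
    ← hx']
  field_simp

include h2u in
/-- **Shimura's Lemma 1.6 on `E_w`, unconditional at a non-dyadic non-split place** (Doc. Math. 13 p. 745
ll. 22–23): two invertible hermitian matrices of the same size over `E_w` are congruent iff their determinants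
differ by a norm `star u · u`. -/
theorem isCongruent_iff_exists_det_eq_local {ι : Type*} [Fintype ι] [DecidableEq ι]
    {H H' : Matrix ι ι (w.adicCompletion E)}
    (hH : letI := localStarRing v w hs hspan hsq c hc; H.IsHermitian)
    (hH' : letI := localStarRing v w hs hspan hsq c hc; H'.IsHermitian) (hdet : IsUnit H.det) :
    letI := localStarRing v w hs hspan hsq c hc
    IsCongruent H H' ↔ ∃ u : w.adicCompletion E, u ≠ 0 ∧ H'.det = star u * u * H.det := by
  letI := localStarRing v w hs hspan hsq c hc
  exact isCongruent_iff_exists_det_eq (exists_add_star_ne_zero_local v w hs hspan hsq c hc)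
    (binaryUniversal v w hs hspan hsq c hc h2u) hH hH' hdet

include h2u in
/-- **Row N2.8.1 (i) on the route's completions, unconditional at a non-dyadic non-split place:** Gram matrices
over `E_w` with `det H' = a · det H`, `a ∈ F_v^×`, are congruent iff `(a, θ)_v = 1` (O'Meara 63:1's equation
`a ξ² + θ η² = 1` solvable in `F_v`). -/
theorem isCongruent_iff_hilbertSolvable_local {ι : Type*} [Fintype ι] [DecidableEq ι]
    {H H' : Matrix ι ι (w.adicCompletion E)}
    (hH : letI := localStarRing v w hs hspan hsq c hc; H.IsHermitian)
    (hH' : letI := localStarRing v w hs hspan hsq c hc; H'.IsHermitian) (hdet : IsUnit H.det)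
    {a : v.adicCompletion F} (ha : a ≠ 0)
    (hdet' : H'.det = algebraMap (v.adicCompletion F) (w.adicCompletion E) a * H.det) :
    letI := localStarRing v w hs hspan hsq c hc
    IsCongruent H H' ↔ HilbertSolvable a (algebraMap F (v.adicCompletion F) θ) := by
  letI := localStarRing v w hs hspan hsq c hc
  -- file 139 states `det H' = a · det H` with this seat's structure map (file 115); p4's is the same map
  have hdet'' : H'.det = T5FinitePlaceLiesOver.completionMap F E v w a * H.det := by
    rw [hdet', algebraMap_apply']
  exact isCongruent_iff_hilbertSolvable v w hs hspan hsq c hc (binaryUniversal v w hs hspan hsq c hc h2u) hH hH'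
    hdet ha hdet''

include h2u in
/-- **HKS96's «precisely two isomorphism classes in each dimension» on `E_w`, unconditional at a non-dyadic
non-split place:** for every `m`, two invertible hermitian `(m+1) × (m+1)` matrices over `E_w`, not congruent,
such that every invertible hermitian matrix is congruent to one of them. -/
theorem exists_two_classes_local' (m : ℕ) :
    letI := localStarRing v w hs hspan hsq c hc
    ∃ H₁ H₂ : Matrix (Fin (m + 1)) (Fin (m + 1)) (w.adicCompletion E),
      H₁.IsHermitian ∧ H₂.IsHermitian ∧ IsUnit H₁.det ∧ IsUnit H₂.det ∧ ¬ IsCongruent H₁ H₂ ∧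
        ∀ H : Matrix (Fin (m + 1)) (Fin (m + 1)) (w.adicCompletion E), H.IsHermitian → IsUnit H.det →
          IsCongruent H H₁ ∨ IsCongruent H H₂ := by
  letI := localStarRing v w hs hspan hsq c hc
  exact exists_two_classes_local v w hs hspan hsq c hc (binaryUniversal v w hs hspan hsq c hc h2u) m

end Universal

end Summit.Ventures.HodgeRepro2.T5FinitePlaceBinaryUniversal
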